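import Summits.CriticalPhenomena.SAWScalingLimit.Theses.SAWLoopAvoidanceChaos
import Literature.Probability.RandomPlanarGeometry.ConformalRestrictionProofs
import Literature.Probability.RandomPlanarGeometry.LoopAvoidanceRegularisedLaw

/-!
# Line `similarity-tangent` for crux `ChaosConformal` (stmt-CriticalPhenomena-4523)

Route `SAWLoopAvoidanceChaos`, crux (U) `ChaosConformal`: every admissible loop-avoidance chaos
limit `Q` (chordal, simple, boundary avoiding, `reg_ε^D(θ) → Q D` in every Dobrushin domain) is
conformally covariant.

DECOMPOSITION (strategist, BC2 redirect). Conformal covariance = GLOBAL EUCLIDEAN SYMMETRY +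
PURE DISTORTION:

* piece 1 `ChaosSimilarityCovariant` — admissible limits are similarity covariant
  (`ChordalFamily.IsSimilarityCovariant`): here from `stub_dilation` (counterterm scale
  calibration: dilations about the origin) and `stub_motion` (cutoff isotropy/homogeneity:
  rotations and translations), composed in `chaosSimilarityCovariant_of_stubs`;
* piece 2 `ChaosTangentUpgrade` — for similarity-covariant admissible limits, covariance under
  conformal maps TANGENT TO THE IDENTITY at an interior point (the transversal to the similarity
  group): here from `stub_schemeCompare` (the Φ-image of the `D`-scheme and the native
  `D'`-scheme are asymptotically equal AT EACH CUTOFF — no limit object in the conclusion) and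
  the proved weak-limit transport, in `chaosTangentUpgrade_of_stubs`;
* assembly `ChaosConformal_of`: every conformal equivalence `g : D → D'` factors as `s ∘ g̃`,
  `s(z) = c z + w`, `c = g'(z₀) ≠ 0` (`ConformalEquiv.exists_deriv_ne_zero`: an injective
  holomorphic map is not locally constant), `g̃ = s⁻¹ ∘ g` tangent to the identity at `z₀`;
  piece 2 transports along `g̃`, piece 1 along `s`, push-forward functoriality closes
  (`ChordalFamily.isConformallyCovariant_of_similarity_of_tangent`).

Sorries ONLY in the three `stub_*` theorems.
-/

noncomputable section

namespace Summit.CriticalPhenomena.SAWScalingLimit.Cruxes.ChaosConformal.SimilarityTangent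

open MeasureTheory Filter Topology Set
open scoped ENNReal NNReal Classical
open Literature.Probability.RandomPlanarGeometry
open Summit.CriticalPhenomena.SAWScalingLimit.Theses

/-! ## 1. The statements of the line (over landed declarations only) -/

/-- **DilationCovariance** (stub 1; counterterm scale calibration). Admissible loop-avoidance chaos
limits (`reg_ε^D(θ) → Q D` in every Dobrushin domain, `Q` chordal, simple, boundary avoiding; the
scheme is `LoopAvoidance.regularisedLaw`, by `rfl` the route's inlined `let` block) are covariant
under dilations `z ↦ r z`, `r > 0`, about the origin (the anchor of the mesh `εℤ²`). For a CONSTANT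
counterterm the `ε`-scheme in `r • D` is exactly the image of the `(ε/r)`-scheme in `D`, so the claim
is that every admissible `θ` is asymptotically constant to the relevant order: the near-critical
window `θ − m ε^(4/3)` (fugacity/massive perturbation, Makarov–Smirnov 2010 Q. 4.12; LSW 2004 §3)
must be excluded by admissibility in EVERY Jordan domain — or this stub is false and the crux must
pin `θ`. [cite: MakarovSmirnov2010, Q. 4.12] -/
def DilationCovariance : Prop :=
  ∀ sle2 : ChordalFamily, (∀ D : DobrushinDomain, IsSLELaw 2 D (sle2 D)) →
  ∀ (θ : ℝ → ℝ) (Q : ChordalFamily), Q.IsChordal →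
  (∀ D : DobrushinDomain, ∀ᵐ γ ∂(Q D),
  γ ∈ CurveClass.simple ∧ γ.range ∩ frontier D.carrier ⊆ {D.pt 0, D.pt 1}) →
  (∀ D : DobrushinDomain, TendstoLaw (fun (_ : ℝ) (x : CurveClass ℂ) => x)
  (LoopAvoidance.regularisedLaw D θ (sle2 D)) id (Q D)) →
  ∀ (D : DobrushinDomain) (r : ℝ) (hr : (r : ℂ) ≠ 0), 0 < r →
  Q (D.map (similarity (r : ℂ) hr 0)) =
  (Q D).map (CurveClass.map (similarity (r : ℂ) hr 0 : C(ℂ, ℂ)))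

/-- **MotionCovariance** (stub 2; cutoff isotropy and homogeneity). Admissible limits are covariant
under rigid motions `z ↦ u z + w`, `‖u‖ = 1`: the limit remembers neither the orientation of the
axis-parallel `ε`-boxes / the mesh-`ε` random-walk soup (only quarter turns are exact symmetries)
nor the offset of the mesh (only `εℤ²`-translations are exact). [cite: KennedyLawler2013, §1] -/
def MotionCovariance : Prop :=
  ∀ sle2 : ChordalFamily, (∀ D : DobrushinDomain, IsSLELaw 2 D (sle2 D)) →
  ∀ (θ : ℝ → ℝ) (Q : ChordalFamily), Q.IsChordal →
  (∀ D : DobrushinDomain, ∀ᵐ γ ∂(Q D),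
  γ ∈ CurveClass.simple ∧ γ.range ∩ frontier D.carrier ⊆ {D.pt 0, D.pt 1}) →
  (∀ D : DobrushinDomain, TendstoLaw (fun (_ : ℝ) (x : CurveClass ℂ) => x)
  (LoopAvoidance.regularisedLaw D θ (sle2 D)) id (Q D)) →
  ∀ (D : DobrushinDomain) (u : ℂ) (hu : u ≠ 0), ‖u‖ = 1 → ∀ w : ℂ,
  Q (D.map (similarity u hu w)) = (Q D).map (CurveClass.map (similarity u hu w : C(ℂ, ℂ)))

/-- **SchemeCompare** (stub 3; variable-cutoff universality, CUTOFF-LEVEL form). For admissible data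
with a similarity-covariant limit and a conformal `g : D → D'` (boundary values at the marked points,
continuous extension `Φ`) TANGENT TO THE IDENTITY at an interior point, the `Φ`-image of `reg_ε^D` and
`reg_ε^(D')` are asymptotically equal as `ε → 0+` (no limit object in the conclusion). Mechanism:
`Φ_* (sle2 D) = sle2 D'` exactly (SLE₂ covariance), so the image law is `sle2 D'` reweighted by the
pulled-back density `dens^D_ε ∘ g⁻¹` (boxes distorted by `|g'| ε`, `≡ ε` to first order at `z₀`;
image random-walk soup); compare with `dens^(D')_ε` via local dilation/rotation covariance and
RW-soup → Brownian-soup under `g` (Lawler–Trujillo Ferreras). [cite: LawlerTrujilloferreras2006, Thm 1.1] -/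
def SchemeCompare : Prop :=
  ∀ sle2 : ChordalFamily, (∀ D : DobrushinDomain, IsSLELaw 2 D (sle2 D)) →
  ∀ (θ : ℝ → ℝ) (Q : ChordalFamily), Q.IsChordal →
  (∀ D : DobrushinDomain, ∀ᵐ γ ∂(Q D),
  γ ∈ CurveClass.simple ∧ γ.range ∩ frontier D.carrier ⊆ {D.pt 0, D.pt 1}) →
  (∀ D : DobrushinDomain, TendstoLaw (fun (_ : ℝ) (x : CurveClass ℂ) => x)
  (LoopAvoidance.regularisedLaw D θ (sle2 D)) id (Q D)) →
  Q.IsSimilarityCovariant →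
  ∀ (D D' : DobrushinDomain) (g : ConformalEquiv D.carrier D'.carrier) (Φ : C(ℂ, ℂ)),
  g.HasBoundaryValue (D.pt 0) (D'.pt 0) → g.HasBoundaryValue (D.pt 1) (D'.pt 1) →
  Set.EqOn Φ g D.carrier →
  (∃ z₀ ∈ D.carrier, g z₀ = z₀ ∧ deriv (fun z : ℂ => g z) z₀ = 1) →
  ∀ (f : BoundedContinuousFunction (CurveClass ℂ) ℝ) (η : ℝ), 0 < η →
  ∀ᶠ ε in 𝓝[>] (0 : ℝ),
  |(∫ x, f x ∂((LoopAvoidance.regularisedLaw D θ (sle2 D) ε).map (CurveClass.map Φ))) -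
  ∫ x, f x ∂(LoopAvoidance.regularisedLaw D' θ (sle2 D') ε)| < η

/-- **Piece 1 of the decomposition — `ChaosSimilarityCovariant`** (VERBATIM the intended route child:
the admissibility block is literally that of `SAWLoopAvoidanceChaos.ChaosConformal`): admissible
limits are similarity covariant. -/
def ChaosSimilarityCovariant : Prop :=
  ∀ sle2 : Literature.Probability.RandomPlanarGeometry.ChordalFamily, (∀ D : Literature.Probability.RandomPlanarGeometry.DobrushinDomain, Literature.Probability.RandomPlanarGeometry.IsSLELaw 2 D (sle2 D)) → ∀ (θ : ℝ → ℝ) (Q : Literature.Probability.RandomPlanarGeometry.ChordalFamily), Q.IsChordal → (∀ D : Literature.Probability.RandomPlanarGeometry.DobrushinDomain, ∀ᵐ γ ∂(Q D), γ ∈ Literature.Probability.RandomPlanarGeometry.CurveClass.simple ∧ γ.range ∩ frontier D.carrier ⊆ {D.pt 0, D.pt 1}) → (∀ D : Literature.Probability.RandomPlanarGeometry.DobrushinDomain, let box : ℝ → Literature.Probability.LatticeModels.Site 2 → Set ℂ := fun ε x => {z : ℂ | |z.re - ε * ((x 0 : ℤ) : ℝ)| ≤ ε / 2 ∧ |z.im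 - ε * ((x 1 : ℤ) : ℝ)| ≤ ε / 2}; let hit : ℝ → Literature.Probability.RandomPlanarGeometry.CurveClass ℂ → Set (Literature.Probability.LatticeModels.Site 2) := fun ε γ => {x | x ∈ Literature.Probability.LatticeModels.meshDomain D.carrier ε ∧ (box ε x ∩ γ.range).Nonempty}; let mass : ℝ → Set (Literature.Probability.LatticeModels.Site 2) → ℝ := fun ε W => ∑' p : (Σ x : Literature.Probability.LatticeModels.Site 2, (Literature.Probability.LatticeModels.discreteDomainGraph D.carrier ε).Walk x x), (if 0 < p.2.length ∧ (∃ v ∈ p.2.support, v ∈ W) then ((1 : ℝ) / 4) ^ p.2.length / (p.2.length : ℝ) else 0); let dens : ℝ → Literature.Probability.RandomPlanarGeometry.CurveClass ℂ → ℝ := fun ε γ => Real.exp (θ ε * ((hit ε γ).ncard : ℝ) - mass ε (hit ε γ)); let reg : ℝ → MeasureTheory.Measure (Literature.Probability.RandomPlanarGeometry.CurveClass ℂ) := fun ε => (∫⁻ γ, ENNReal.ofReal (dens ε γ) ∂(sle2 D))⁻¹ • (sle2 D).withDensity (fun γ => ENNReal.ofReal (dens ε γ)); Literature.Probability.RandomPlanarGeometry.TendstoLaw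 (fun (_ : ℝ) (x : Literature.Probability.RandomPlanarGeometry.CurveClass ℂ) => x) reg id (Q D)) → Q.IsSimilarityCovariant

/-- **Piece 2 of the decomposition — `ChaosTangentUpgrade`** (VERBATIM the intended route child):
for similarity-covariant admissible limits, covariance under conformal maps tangent to the identity
at an interior point. -/
def ChaosTangentUpgrade : Prop :=
  ∀ sle2 : Literature.Probability.RandomPlanarGeometry.ChordalFamily, (∀ D : Literature.Probability.RandomPlanarGeometry.DobrushinDomain, Literature.Probability.RandomPlanarGeometry.IsSLELaw 2 D (sle2 D)) → ∀ (θ : ℝ → ℝ) (Q : Literature.Probability.RandomPlanarGeometry.ChordalFamily), Q.IsChordal → (∀ D : Literature.Probability.RandomPlanarGeometry.DobrushinDomain, ∀ᵐ γ ∂(Q D), γ ∈ Literature.Probability.RandomPlanarGeometry.CurveClass.simple ∧ γ.range ∩ frontier D.carrier ⊆ {D.pt 0, D.pt 1}) → (∀ D : Literature.Probability.RandomPlanarGeometry.DobrushinDomain, let box : ℝ → Literature.Probability.LatticeModels.Site 2 → Set ℂ := fun ε x => {z : ℂ | |z.re - ε * ((x 0 : ℤ) : ℝ)| ≤ ε /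 2 ∧ |z.im - ε * ((x 1 : ℤ) : ℝ)| ≤ ε / 2}; let hit : ℝ → Literature.Probability.RandomPlanarGeometry.CurveClass ℂ → Set (Literature.Probability.LatticeModels.Site 2) := fun ε γ => {x | x ∈ Literature.Probability.LatticeModels.meshDomain D.carrier ε ∧ (box ε x ∩ γ.range).Nonempty}; let mass : ℝ → Set (Literature.Probability.LatticeModels.Site 2) → ℝ := fun ε W => ∑' p : (Σ x : Literature.Probability.LatticeModels.Site 2, (Literature.Probability.LatticeModels.discreteDomainGraph D.carrier ε).Walk x x), (if 0 < p.2.length ∧ (∃ v ∈ p.2.support, v ∈ W) then ((1 : ℝ) / 4) ^ p.2.length / (p.2.length : ℝ) else 0); let dens : ℝ → Literature.Probability.RandomPlanarGeometry.CurveClass ℂ → ℝ := fun ε γ => Real.exp (θ ε * ((hit ε γ).ncard : ℝ) - mass ε (hit ε γ)); let reg : ℝ → MeasureTheory.Measure (Literature.Probability.RandomPlanarGeometry.CurveClass ℂ) := fun ε => (∫⁻ γ, ENNReal.ofReal (dens ε γ) ∂(sle2 D))⁻¹ • (sle2 D).withDensity (fun γ => ENNReal.ofReal (dens ε γ)); Literature.Probability.RandomPlanarGeometry.TendstoLaw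 (fun (_ : ℝ) (x : Literature.Probability.RandomPlanarGeometry.CurveClass ℂ) => x) reg id (Q D)) → Q.IsSimilarityCovariant → ∀ (D D' : Literature.Probability.RandomPlanarGeometry.DobrushinDomain) (g : Literature.Probability.RandomPlanarGeometry.ConformalEquiv D.carrier D'.carrier) (Φ : C(ℂ, ℂ)), g.HasBoundaryValue (D.pt 0) (D'.pt 0) → g.HasBoundaryValue (D.pt 1) (D'.pt 1) → Set.EqOn Φ g D.carrier → (∃ z₀ ∈ D.carrier, g z₀ = z₀ ∧ deriv (fun z : ℂ => g z) z₀ = 1) → Q D' = (Q D).map (Literature.Probability.RandomPlanarGeometry.CurveClass.map Φ)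

/-! ## 2. Registered stubs (literal statements; `Registered.stub_*` are their name-keyed aliases) -/

namespace Registered

abbrev stub_dilation : Prop := DilationCovariance
abbrev stub_motion : Prop := MotionCovariance
abbrev stub_schemeCompare : Prop := SchemeCompare

end Registered

/-- STUB 1 (L–XL; possibly false as typed — see `DilationCovariance`): dilation covariance. -/
theorem stub_dilation :
    ∀ sle2 : ChordalFamily, (∀ D : DobrushinDomain, IsSLELaw 2 D (sle2 D)) →
    ∀ (θ : ℝ → ℝ) (Q : ChordalFamily), Q.IsChordal →
    (∀ D : DobrushinDomain, ∀ᵐ γ ∂(Q D),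
    γ ∈ CurveClass.simple ∧ γ.range ∩ frontier D.carrier ⊆ {D.pt 0, D.pt 1}) →
    (∀ D : DobrushinDomain, TendstoLaw (fun (_ : ℝ) (x : CurveClass ℂ) => x)
    (LoopAvoidance.regularisedLaw D θ (sle2 D)) id (Q D)) →
    ∀ (D : DobrushinDomain) (r : ℝ) (hr : (r : ℂ) ≠ 0), 0 < r →
    Q (D.map (similarity (r : ℂ) hr 0)) =
    (Q D).map (CurveClass.map (similarity (r : ℂ) hr 0 : C(ℂ, ℂ))) := by
  sorry

/-- STUB 2 (L): rigid-motion covariance (cutoff isotropy / homogeneity). -/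
theorem stub_motion :
    ∀ sle2 : ChordalFamily, (∀ D : DobrushinDomain, IsSLELaw 2 D (sle2 D)) →
    ∀ (θ : ℝ → ℝ) (Q : ChordalFamily), Q.IsChordal →
    (∀ D : DobrushinDomain, ∀ᵐ γ ∂(Q D),
    γ ∈ CurveClass.simple ∧ γ.range ∩ frontier D.carrier ⊆ {D.pt 0, D.pt 1}) →
    (∀ D : DobrushinDomain, TendstoLaw (fun (_ : ℝ) (x : CurveClass ℂ) => x)
    (LoopAvoidance.regularisedLaw D θ (sle2 D)) id (Q D)) →
    ∀ (D : DobrushinDomain) (u : ℂ) (hu : u ≠ 0), ‖u‖ = 1 → ∀ w : ℂ,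
    Q (D.map (similarity u hu w)) = (Q D).map (CurveClass.map (similarity u hu w : C(ℂ, ℂ))) := by
  sorry

/-- STUB 3 (XL, HARDEST): cutoff-level comparison of the transported and the native scheme. -/
theorem stub_schemeCompare :
    ∀ sle2 : ChordalFamily, (∀ D : DobrushinDomain, IsSLELaw 2 D (sle2 D)) →
    ∀ (θ : ℝ → ℝ) (Q : ChordalFamily), Q.IsChordal →
    (∀ D : DobrushinDomain, ∀ᵐ γ ∂(Q D),
    γ ∈ CurveClass.simple ∧ γ.range ∩ frontier D.carrier ⊆ {D.pt 0, D.pt 1}) →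
    (∀ D : DobrushinDomain, TendstoLaw (fun (_ : ℝ) (x : CurveClass ℂ) => x)
    (LoopAvoidance.regularisedLaw D θ (sle2 D)) id (Q D)) →
    Q.IsSimilarityCovariant →
    ∀ (D D' : DobrushinDomain) (g : ConformalEquiv D.carrier D'.carrier) (Φ : C(ℂ, ℂ)),
    g.HasBoundaryValue (D.pt 0) (D'.pt 0) → g.HasBoundaryValue (D.pt 1) (D'.pt 1) →
    Set.EqOn Φ g D.carrier →
    (∃ z₀ ∈ D.carrier, g z₀ = z₀ ∧ deriv (fun z : ℂ => g z) z₀ = 1) →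
    ∀ (f : BoundedContinuousFunction (CurveClass ℂ) ℝ) (η : ℝ), 0 < η →
    ∀ᶠ ε in 𝓝[>] (0 : ℝ),
    |(∫ x, f x ∂((LoopAvoidance.regularisedLaw D θ (sle2 D) ε).map (CurveClass.map Φ))) -
    ∫ x, f x ∂(LoopAvoidance.regularisedLaw D' θ (sle2 D') ε)| < η := by
  sorry

/-! The literal stubs are, by `Iff.rfl`, the named statements of §1. -/
example : DilationCovariance := stub_dilation
example : MotionCovariance := stub_motion
example : SchemeCompare := stub_schemeCompare

/-! ## 3. Glue (sorry-free) -/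

/-! ### 3a. Similarities are generated by dilations and rigid motions -/

/-- Image of a marked domain under a composite homeomorphism. [folklore] -/
theorem markedDomain_map_trans {n : ℕ} (D : MarkedDomain n) (φ ψ : ℂ ≃ₜ ℂ) :
    D.map (φ.trans ψ) = (D.map φ).map ψ := by
  obtain ⟨⟨carrier, boundary, h1, h2, h3, h4, h5, h6, h7⟩, mark, hm1, hm2⟩ := D
  simp only [MarkedDomain.map, JordanDomain.map, MarkedDomain.mk.injEq, JordanDomain.mk.injEq,
    and_true]
  exact ⟨Set.image_comp ψ φ carrier, rfl⟩

/-- Functoriality of the push-forward of curve classes. [folklore] -/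
theorem curveClass_map_comp (φ ψ : C(ℂ, ℂ)) :
    CurveClass.map ψ ∘ CurveClass.map φ = CurveClass.map (ψ.comp φ) := by
  funext γ
  obtain ⟨γ', rfl⟩ := CurveClass.surjective_mk γ
  simp only [Function.comp_apply, CurveClass.map_mk]
  rfl

/-- **Piece 1 from its stubs.** Dilation covariance and rigid-motion covariance give similarity
covariance: `c z + w = u (r z) + w` with `r = ‖c‖`, `u = c / ‖c‖`. [folklore] -/
theorem isSimilarityCovariant_of_dilation_of_motion (Q : ChordalFamily)
    (hdil : ∀ (D : DobrushinDomain) (r : ℝ) (hr : (r : ℂ) ≠ 0), 0 < r →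
      Q (D.map (similarity (r : ℂ) hr 0)) =
        (Q D).map (CurveClass.map (similarity (r : ℂ) hr 0 : C(ℂ, ℂ))))
    (hmot : ∀ (D : DobrushinDomain) (u : ℂ) (hu : u ≠ 0), ‖u‖ = 1 → ∀ w : ℂ,
      Q (D.map (similarity u hu w)) = (Q D).map (CurveClass.map (similarity u hu w : C(ℂ, ℂ)))) :
    Q.IsSimilarityCovariant := by
  intro D c hc w
  have hr : 0 < ‖c‖ := norm_pos_iff.2 hc
  have hrc : ((‖c‖ : ℝ) : ℂ) ≠ 0 := by exact_mod_cast hr.ne'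
  set u : ℂ := c / (‖c‖ : ℂ) with hu_def
  have hu : u ≠ 0 := div_ne_zero hc hrc
  have hun : ‖u‖ = 1 := by
    rw [hu_def, norm_div, Complex.norm_real, Real.norm_eq_abs, abs_of_pos hr, div_self hr.ne']
  set sr : ℂ ≃ₜ ℂ := similarity ((‖c‖ : ℝ) : ℂ) hrc 0 with hsr
  set su : ℂ ≃ₜ ℂ := similarity u hu w with hsu
  have hfac : similarity c hc w = sr.trans su := by
    ext z
    rw [Homeomorph.trans_apply, hsr, hsu, similarity_apply, similarity_apply, similarity_apply,
      hu_def, add_zero, ← mul_assoc, div_mul_cancel₀ c hrc]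
  have hfacC : (similarity c hc w : C(ℂ, ℂ)) = (su : C(ℂ, ℂ)).comp (sr : C(ℂ, ℂ)) := by
    ext z
    exact congrFun (congrArg (fun h : ℂ ≃ₜ ℂ => (h : ℂ → ℂ)) hfac) z
  have hmsr : Measurable (CurveClass.map (sr : C(ℂ, ℂ))) := CurveClass.measurable_map _
  have hmsu : Measurable (CurveClass.map (su : C(ℂ, ℂ))) := CurveClass.measurable_map _
  rw [hfac, markedDomain_map_trans, hmot (D.map sr) u hu hun w, hdil D ‖c‖ hrc hr,
    Measure.map_map hmsu hmsr, curveClass_map_comp, ← hfacC, ← hfac]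

/-! ### 3b. Weak-limit transport (cutoff-level comparison ⇒ covariance) -/

/-- Uniqueness of weak limits in difference form (Billingsley 1999, Thm 1.2). [folklore] -/
theorem eq_of_tendsto_of_eventually_abs_sub_lt {u v : ℝ → ℝ} {A B : ℝ}
    (hu : Tendsto u (𝓝[>] (0 : ℝ)) (𝓝 A)) (hv : Tendsto v (𝓝[>] (0 : ℝ)) (𝓝 B))
    (huv : ∀ η : ℝ, 0 < η → ∀ᶠ ε in 𝓝[>] (0 : ℝ), |u ε - v ε| < η) : A = B := by
  have h0 : Tendsto (fun ε => u ε - v ε) (𝓝[>] (0 : ℝ)) (𝓝 0) := by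
    rw [Metric.tendsto_nhds]
    intro η hη
    filter_upwards [huv η hη] with ε hε
    rwa [Real.dist_eq, sub_zero]
  have h1 : Tendsto (fun ε => u ε - v ε) (𝓝[>] (0 : ℝ)) (𝓝 (A - B)) := hu.sub hv
  exact sub_eq_zero.1 (tendsto_nhds_unique h1 h0)

/-- **Weak-limit transport.** If `μ_ε → ν` weakly, `ν, ν'` are probability measures and the
`F`-images of `μ_ε` are asymptotically equal to laws `μ'_ε → ν'`, then `ν' = F_* ν`. [folklore] -/
theorem map_eq_of_schemeCompare {μ μ' : ℝ → Measure (CurveClass ℂ)} {ν ν' : Measure (CurveClass ℂ)}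
    [IsProbabilityMeasure ν] [IsProbabilityMeasure ν'] (F : C(ℂ, ℂ))
    (hμ : TendstoLaw (fun (_ : ℝ) (x : CurveClass ℂ) => x) μ id ν)
    (hμ' : TendstoLaw (fun (_ : ℝ) (x : CurveClass ℂ) => x) μ' id ν')
    (hcmp : ∀ (f : BoundedContinuousFunction (CurveClass ℂ) ℝ) (η : ℝ), 0 < η →
      ∀ᶠ ε in 𝓝[>] (0 : ℝ),
        |(∫ x, f x ∂((μ ε).map (CurveClass.map F))) - ∫ x, f x ∂(μ' ε)| < η) :
    ν' = ν.map (CurveClass.map F) := by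
  have hFm : Measurable (CurveClass.map F) := CurveClass.measurable_map F
  haveI : IsProbabilityMeasure (ν.map (CurveClass.map F)) :=
    Measure.isProbabilityMeasure_map hFm.aemeasurable
  refine (ext_of_forall_integral_eq_of_IsFiniteMeasure fun f => ?_).symm
  -- the test function `f ∘ map F` is bounded continuous
  let fF : BoundedContinuousFunction (CurveClass ℂ) ℝ :=
    f.compContinuous ⟨CurveClass.map F, CurveClass.continuous_map F⟩
  have hA : Tendsto (fun ε => ∫ x, f x ∂((μ ε).map (CurveClass.map F))) (𝓝[>] (0 : ℝ))
      (𝓝 (∫ x, f x ∂(ν.map (CurveClass.map F)))) := by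
    have h := hμ fF
    have e1 : ∀ ρ : Measure (CurveClass ℂ),
        ∫ x, f x ∂(ρ.map (CurveClass.map F)) = ∫ ω, fF ω ∂ρ := by
      intro ρ
      rw [integral_map hFm.aemeasurable f.continuous.aestronglyMeasurable]
      rfl
    simp_rw [e1]
    simpa only [id] using h
  have hB : Tendsto (fun ε => ∫ x, f x ∂(μ' ε)) (𝓝[>] (0 : ℝ)) (𝓝 (∫ x, f x ∂ν')) := by
    have h := hμ' f
    simpa only [id] using h
  exact eq_of_tendsto_of_eventually_abs_sub_lt hA hB (hcmp f)

/-! ### 3c. Similarity ⊕ tangent ⇒ conformal -/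

variable {U V : Set ℂ}

/-- An injective holomorphic map on a nonempty open set has a point where its derivative does not
vanish (otherwise it would be constant on a ball). [folklore] -/
theorem ConformalEquiv.exists_deriv_ne_zero (g : ConformalEquiv U V) (hU : IsOpen U)
    (hne : U.Nonempty) : ∃ z₀ ∈ U, deriv (fun z : ℂ => g z) z₀ ≠ 0 := by
  by_contra h
  push Not at h
  obtain ⟨z₁, hz₁⟩ := hne
  obtain ⟨r, hr, hball⟩ := Metric.isOpen_iff.1 hU z₁ hz₁
  have hdiff : DifferentiableOn ℂ (fun z : ℂ => g z) (Metric.ball z₁ r) :=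
    g.differentiableOn_coe.mono hball
  have hconst : ∀ x ∈ Metric.ball z₁ r, ∀ y ∈ Metric.ball z₁ r,
      (fun z : ℂ => g z) x = (fun z : ℂ => g z) y := by
    intro x hx y hy
    refine (convex_ball z₁ r).is_const_of_fderivWithin_eq_zero hdiff ?_ hx hy
    intro z hz
    rw [fderivWithin_of_isOpen Metric.isOpen_ball hz]
    have hd : deriv (fun z : ℂ => g z) z = 0 := h z (hball hz)
    refine ContinuousLinearMap.ext_ring ?_
    rw [fderiv_apply_one_eq_deriv, hd]
    simp
  have hz₂ : z₁ + ((r / 2 : ℝ) : ℂ) ∈ Metric.ball z₁ r := by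
    rw [Metric.mem_ball, dist_eq_norm]
    simp only [add_sub_cancel_left, Complex.norm_real, Real.norm_eq_abs]
    rw [abs_of_pos (half_pos hr)]
    linarith
  have heq := hconst z₁ (Metric.mem_ball_self hr) _ hz₂
  have hinj := g.injOn hz₁ (hball hz₂) heq
  have : ((r / 2 : ℝ) : ℂ) = 0 := by
    have := congrArg (fun z => z - z₁) hinj
    simpa using this.symm
  have hr2 : (r / 2 : ℝ) = 0 := by exact_mod_cast this
  linarith

/-- **Similarity covariance + tangent covariance ⇒ conformal covariance**: every conformal
equivalence factors as a similarity after a map tangent to the identity. [folklore] -/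
theorem ChordalFamily.isConformallyCovariant_of_similarity_of_tangent (Q : ChordalFamily)
    (hsim : Q.IsSimilarityCovariant)
    (htan : ∀ (D D' : DobrushinDomain) (g : ConformalEquiv D.carrier D'.carrier) (Φ : C(ℂ, ℂ)),
      g.HasBoundaryValue (D.pt 0) (D'.pt 0) → g.HasBoundaryValue (D.pt 1) (D'.pt 1) →
      Set.EqOn Φ g D.carrier →
      (∃ z₀ ∈ D.carrier, g z₀ = z₀ ∧ deriv (fun z : ℂ => g z) z₀ = 1) →
      Q D' = (Q D).map (CurveClass.map Φ)) :
    Q.IsConformallyCovariant := by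
  intro D D' g Φ h0 h1 hEq
  obtain ⟨z₀, hz₀, hc⟩ := ConformalEquiv.exists_deriv_ne_zero g D.isOpen D.nonempty
  set c : ℂ := deriv (fun z : ℂ => g z) z₀ with hc_def
  set w : ℂ := g z₀ - c * z₀ with hw_def
  have hc' : c⁻¹ ≠ 0 := inv_ne_zero hc
  set s : ℂ ≃ₜ ℂ := similarity c hc w with hs_def
  set s' : ℂ ≃ₜ ℂ := similarity c⁻¹ hc' (-(c⁻¹ * w)) with hs'_def
  have hss' : ∀ z, s (s' z) = z := by
    intro z
    simp only [hs_def, hs'_def, similarity_apply]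
    field_simp
    ring
  let e : ConformalEquiv D'.carrier (similarity c⁻¹ hc' (-(c⁻¹ * w)) '' D'.carrier) :=
    ChordalFamily.similarityConformalEquiv c⁻¹ hc' (-(c⁻¹ * w)) D'.carrier
  let gt : ConformalEquiv D.carrier (D'.map s').carrier := g.trans e
  have hgt : ∀ z, gt z = c⁻¹ * g z + -(c⁻¹ * w) := fun z => rfl
  let Φt : C(ℂ, ℂ) := (s' : C(ℂ, ℂ)).comp Φ
  have hΦt : ∀ z, Φt z = c⁻¹ * Φ z + -(c⁻¹ * w) := fun z => rfl
  have hbv : ∀ {x p : ℂ}, g.HasBoundaryValue x p → gt.HasBoundaryValue x (s' p) := by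
    intro x p h
    have h2 : Tendsto (fun z => s' (g z)) (𝓝[D.carrier] x) (𝓝 (s' p)) :=
      (s'.continuous.tendsto p).comp h
    exact h2
  have hbv0 : gt.HasBoundaryValue (D.pt 0) ((D'.map s').pt 0) := by
    rw [MarkedDomain.pt_map]; exact hbv h0
  have hbv1 : gt.HasBoundaryValue (D.pt 1) ((D'.map s').pt 1) := by
    rw [MarkedDomain.pt_map]; exact hbv h1
  have hEqt : Set.EqOn Φt gt D.carrier := by
    intro z hz
    rw [hΦt, hgt, hEq hz]
  have htangent : ∃ z ∈ D.carrier, gt z = z ∧ deriv (fun z : ℂ => gt z) z = 1 := by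
    refine ⟨z₀, hz₀, ?_, ?_⟩
    · rw [hgt, hw_def]
      field_simp
      ring
    · have hfun : (fun z : ℂ => gt z) = fun z => c⁻¹ * g z + -(c⁻¹ * w) := funext hgt
      have hdz : DifferentiableAt ℂ (fun z : ℂ => g z) z₀ :=
        g.differentiableOn_coe.differentiableAt (D.isOpen.mem_nhds hz₀)
      rw [hfun, deriv_add_const, deriv_const_mul _ hdz, ← hc_def, inv_mul_cancel₀ hc]
  have key := htan D (D'.map s') gt Φt hbv0 hbv1 hEqt htangent
  have hsimD' : Q (D'.map s') = (Q D').map (CurveClass.map (s' : C(ℂ, ℂ))) :=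
    hsim D' c⁻¹ hc' (-(c⁻¹ * w))
  have hms : Measurable (CurveClass.map (s : C(ℂ, ℂ))) := CurveClass.measurable_map _
  have hms' : Measurable (CurveClass.map (s' : C(ℂ, ℂ))) := CurveClass.measurable_map _
  have hmΦ : Measurable (CurveClass.map Φ) := CurveClass.measurable_map _
  have hcancel : CurveClass.map (s : C(ℂ, ℂ)) ∘ CurveClass.map (s' : C(ℂ, ℂ)) = id := by
    funext γ
    obtain ⟨γ', rfl⟩ := CurveClass.surjective_mk γ
    show CurveClass.map (s : C(ℂ, ℂ)) (CurveClass.map (s' : C(ℂ, ℂ)) (CurveClass.mk γ')) =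
      CurveClass.mk γ'
    rw [CurveClass.map_mk, CurveClass.map_mk]
    congr 1
    ext t
    exact hss' _
  have hcomp : CurveClass.map (s' : C(ℂ, ℂ)) ∘ CurveClass.map Φ = CurveClass.map Φt := by
    funext γ
    obtain ⟨γ', rfl⟩ := CurveClass.surjective_mk γ
    simp only [Function.comp_apply, CurveClass.map_mk]
    rfl
  have h3 : (Q D').map (CurveClass.map (s' : C(ℂ, ℂ))) =
      ((Q D).map (CurveClass.map Φ)).map (CurveClass.map (s' : C(ℂ, ℂ))) := by
    rw [← hsimD', key, Measure.map_map hms' hmΦ, hcomp]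
  have h4 : ((Q D').map (CurveClass.map (s' : C(ℂ, ℂ)))).map (CurveClass.map (s : C(ℂ, ℂ))) =
      (((Q D).map (CurveClass.map Φ)).map (CurveClass.map (s' : C(ℂ, ℂ)))).map
        (CurveClass.map (s : C(ℂ, ℂ))) :=
    congrArg (fun μ : Measure (CurveClass ℂ) => μ.map (CurveClass.map (s : C(ℂ, ℂ)))) h3
  rw [Measure.map_map hms hms', Measure.map_map hms hms', hcancel, Measure.map_id,
    Measure.map_id] at h4
  exact h4

/-! ## 4. The pieces from the stubs, the assembly, and the crux BY NAME -/

/-- Bridge: the route's inlined `let` block is `LoopAvoidance.regularisedLaw` (`rfl`). -/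
theorem tendstoLaw_of_inlined {sle2 : ChordalFamily} {θ : ℝ → ℝ} {Q : ChordalFamily}
    (hconv : ∀ D : DobrushinDomain,
      let box : ℝ → Literature.Probability.LatticeModels.Site 2 → Set ℂ := fun ε x =>
        {z : ℂ | |z.re - ε * ((x 0 : ℤ) : ℝ)| ≤ ε / 2 ∧ |z.im - ε * ((x 1 : ℤ) : ℝ)| ≤ ε / 2}
      let hit : ℝ → CurveClass ℂ → Set (Literature.Probability.LatticeModels.Site 2) := fun ε γ =>
        {x | x ∈ Literature.Probability.LatticeModels.meshDomain D.carrier ε ∧ (box ε x ∩ γ.range).Nonempty}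
      let mass : ℝ → Set (Literature.Probability.LatticeModels.Site 2) → ℝ := fun ε W =>
        ∑' p : (Σ x : Literature.Probability.LatticeModels.Site 2,
            (Literature.Probability.LatticeModels.discreteDomainGraph D.carrier ε).Walk x x),
          (if 0 < p.2.length ∧ (∃ v ∈ p.2.support, v ∈ W) then
            ((1 : ℝ) / 4) ^ p.2.length / (p.2.length : ℝ) else 0)
      let dens : ℝ → CurveClass ℂ → ℝ := fun ε γ =>
        Real.exp (θ ε * ((hit ε γ).ncard : ℝ) - mass ε (hit ε γ))
      let reg : ℝ → Measure (CurveClass ℂ) := fun ε =>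
        (∫⁻ γ, ENNReal.ofReal (dens ε γ) ∂(sle2 D))⁻¹ •
          (sle2 D).withDensity (fun γ => ENNReal.ofReal (dens ε γ))
      TendstoLaw (fun (_ : ℝ) (x : CurveClass ℂ) => x) reg id (Q D)) :
    ∀ D : DobrushinDomain, TendstoLaw (fun (_ : ℝ) (x : CurveClass ℂ) => x)
      (LoopAvoidance.regularisedLaw D θ (sle2 D)) id (Q D) :=
  fun D => hconv D

/-- **Piece 1 from stubs 1–2** (`isSimilarityCovariant_of_dilation_of_motion`). -/
theorem chaosSimilarityCovariant_of_stubs (h1 : Registered.stub_dilation)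
    (h2 : Registered.stub_motion) : ChaosSimilarityCovariant := by
  intro sle2 hsle2 θ Q hQ hsimple hconv
  have hconv' := tendstoLaw_of_inlined hconv
  exact isSimilarityCovariant_of_dilation_of_motion Q (h1 sle2 hsle2 θ Q hQ hsimple hconv')
    (h2 sle2 hsle2 θ Q hQ hsimple hconv')

/-- **Piece 2 from stub 3** (`map_eq_of_schemeCompare`: continuous mapping + uniqueness of weak
limits turn the cutoff-level comparison into covariance of the limit). -/
theorem chaosTangentUpgrade_of_stubs (h3 : Registered.stub_schemeCompare) : ChaosTangentUpgrade := by
  intro sle2 hsle2 θ Q hQ hsimple hconv hsim D D' g Φ h0 h1 hEq htan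
  have hconv' := tendstoLaw_of_inlined hconv
  haveI : IsProbabilityMeasure (Q D) := (hQ D).1
  haveI : IsProbabilityMeasure (Q D') := (hQ D').1
  exact map_eq_of_schemeCompare Φ (hconv' D) (hconv' D')
    (h3 sle2 hsle2 θ Q hQ hsimple hconv' hsim D D' g Φ h0 h1 hEq htan)

/-- **ASSEMBLY of the decomposition: `ChaosSimilarityCovariant → ChaosTangentUpgrade →
ChaosConformal`** (factor every conformal equivalence through a similarity and a map tangent to the
identity; `ChordalFamily.isConformallyCovariant_of_similarity_of_tangent`). -/
theorem ChaosConformal_of_pieces (hP1 : ChaosSimilarityCovariant) (hP2 : ChaosTangentUpgrade) :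
    SAWLoopAvoidanceChaos.ChaosConformal := by
  intro sle2 hsle2 θ Q hQ hsimple hconv
  have hsim : Q.IsSimilarityCovariant := hP1 sle2 hsle2 θ Q hQ hsimple hconv
  exact ChordalFamily.isConformallyCovariant_of_similarity_of_tangent Q hsim
    (hP2 sle2 hsle2 θ Q hQ hsimple hconv hsim)

/-- **`ChaosConformal_of` (kernel-checked, no `sorry` here): stub_dilation → stub_motion →
stub_schemeCompare → `SAWLoopAvoidanceChaos.ChaosConformal`.** -/
theorem ChaosConformal_of (h1 : Registered.stub_dilation) (h2 : Registered.stub_motion)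
    (h3 : Registered.stub_schemeCompare) : SAWLoopAvoidanceChaos.ChaosConformal :=
  ChaosConformal_of_pieces (chaosSimilarityCovariant_of_stubs h1 h2)
    (chaosTangentUpgrade_of_stubs h3)

end Summit.CriticalPhenomena.SAWScalingLimit.Cruxes.ChaosConformal.SimilarityTangent
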